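import Mathlib
import Literature.Probability.RandomPlanarGeometry.LoopConfigurationsMetric
import HarnessLib

/-!
# Stub `stub_treeRigidity`, law-level step (2): coupling two presentations along equal laws of a statistic

Crux `Summit.CriticalPhenomena.CardyFormulaZ2.Theses.CardyMagicRigidity.NestingRigidity`
(stmt-CriticalPhenomena-4835), line `positive-cone-weight-doubling`, registered stub `stub_treeRigidity`.
The law-level form of the reconstruction step (2) (configuration level: `…TransferRigidity`,
`…TreeRigidityReconstruction`, p118827/p128704) needs ONE measure-theoretic device, independent of the support
predicate: if a measurable statistic `Φ` (for the stub: the countable vector of typed one- and two-disc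
surround counts at rational data, with values in the standard Borel space `ℕ^ℕ`) has the SAME LAW under the two
limit presentations `X, X' : ([0,1], Leb) → C`, then the two presentations can be COUPLED so that the statistic
agrees almost surely — after which the deterministic rigidity theorem applies pathwise and yields
`d_CN`-closeness on the coupling, i.e. `cnLawEDist volume X volume X' = 0`.

* `exists_coupling_eq_of_map_eq` — for measurable `f : α → γ`, `g : β → γ` into a standard Borel space with
  `μ.map f = ν.map g` (`μ`, `ν` probability laws on standard Borel spaces), there is a coupling `π` of `μ`
  and `ν` with `f p.1 = g p.2` for `π`-a.e. `p`.  Proof: glue (`LoopConfig.exists_glued_coupling`, the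
  disintegration gluing lemma of the tree) the deterministic couplings `(a, f a)` of `μ` with the common law
  and `(g b, b)` of the common law with `ν`; the event `{f a ≠ g b}` is covered through every middle point
  `y` by `{f a ≠ y} ∪ {y ≠ g b}`, both null on the respective graphs.
* `exists_coupling_volume_eq_of_map_eq` (registered anchor) — the case `α = β = [0, 1]` with Lebesgue
  measure, the presentation space of `PrecompactRegular` / `TreeRigidity`.

(The single-family hypothesis `NestingLawAgreement` does NOT give equality of the law of this joint statistic:
`exists_regular_laws_familywise_eq_jointly_ne`, p129546; the reshaped stub must assume joint agreement.)
-/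

noncomputable section

open MeasureTheory Set Filter
open scoped Topology BigOperators ENNReal

namespace Summit.CriticalPhenomena.CardyFormulaZ2.Cruxes.NestingRigidity.PositiveConeWeightDoubling

open Literature.Probability.RandomPlanarGeometry

/-- **Coupling along equal laws of a statistic.**  Let `μ`, `ν` be probability measures on standard Borel
spaces `α`, `β`, and `f : α → γ`, `g : β → γ` measurable maps into a standard Borel space with the same law,
`μ.map f = ν.map g`.  Then there is a coupling `π` of `μ` and `ν` (a measure on `α × β` with these marginals)
under which `f p.1 = g p.2` almost surely. -/
theorem exists_coupling_eq_of_map_eq {α β γ : Type*} [MeasurableSpace α] [StandardBorelSpace α]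
    [Nonempty α] [MeasurableSpace β] [StandardBorelSpace β] [Nonempty β] [MeasurableSpace γ]
    [StandardBorelSpace γ] (μ : Measure α) (ν : Measure β) [IsProbabilityMeasure μ]
    [IsProbabilityMeasure ν] {f : α → γ} {g : β → γ} (hf : Measurable f) (hg : Measurable g)
    (h : μ.map f = ν.map g) :
    ∃ π : Measure (α × β), π.map Prod.fst = μ ∧ π.map Prod.snd = ν ∧ ∀ᵐ p ∂π, f p.1 = g p.2 := by
  -- read `γ` inside `ℝ` to get measurable equality events
  obtain ⟨e, he⟩ := MeasureTheory.exists_measurableEmbedding_real γ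
  have hmeasA : MeasurableSet {p : α × γ | f p.1 ≠ p.2} := by
    have : {p : α × γ | f p.1 ≠ p.2} = {p | e (f p.1) = e p.2}ᶜ := by
      ext p; simp [he.injective.eq_iff]
    rw [this]
    exact (measurableSet_eq_fun (he.measurable.comp (hf.comp measurable_fst))
      (he.measurable.comp measurable_snd)).compl
  have hmeasB : MeasurableSet {p : γ × β | p.1 ≠ g p.2} := by
    have : {p : γ × β | p.1 ≠ g p.2} = {p | e p.1 = e (g p.2)}ᶜ := by
      ext p; simp [he.injective.eq_iff]
    rw [this]
    exact (measurableSet_eq_fun (he.measurable.comp measurable_fst)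
      (he.measurable.comp (hg.comp measurable_snd))).compl
  have hmeasC : MeasurableSet {p : α × β | f p.1 ≠ g p.2} := by
    have : {p : α × β | f p.1 ≠ g p.2} = {p | e (f p.1) = e (g p.2)}ᶜ := by
      ext p; simp [he.injective.eq_iff]
    rw [this]
    exact (measurableSet_eq_fun (he.measurable.comp (hf.comp measurable_fst))
      (he.measurable.comp (hg.comp measurable_snd))).compl
  -- the two deterministic couplings through the common law
  have hF : Measurable fun a : α ↦ (a, f a) := measurable_id.prodMk hf
  have hG : Measurable fun b : β ↦ (g b, b) := hg.prodMk measurable_id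
  set P : Measure (α × γ) := μ.map fun a ↦ (a, f a) with hP
  set Q : Measure (γ × β) := ν.map fun b ↦ (g b, b) with hQ
  haveI : IsProbabilityMeasure P := Measure.isProbabilityMeasure_map hF.aemeasurable
  haveI : IsProbabilityMeasure Q := Measure.isProbabilityMeasure_map hG.aemeasurable
  have hmid : P.map Prod.snd = Q.map Prod.fst := by
    rw [hP, hQ, Measure.map_map measurable_snd hF, Measure.map_map measurable_fst hG]
    exact h
  obtain ⟨T, hT₁, hT₂, hT⟩ := LoopConfig.exists_glued_coupling P Q hmid
  refine ⟨T, ?_, ?_, ?_⟩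
  · rw [hT₁, hP, Measure.map_map measurable_fst hF]
    exact Measure.map_id
  · rw [hT₂, hQ, Measure.map_map measurable_snd hG]
    exact Measure.map_id
  · rw [ae_iff]
    refine le_antisymm ?_ bot_le
    have key := hT hmeasA hmeasB hmeasC fun a y b (hab : f a ≠ g b) ↦ by
      by_cases hy : f a = y
      · exact Or.inr (hy ▸ hab)
      · exact Or.inl hy
    have hPA : P {p : α × γ | f p.1 ≠ p.2} = 0 := by
      rw [hP, Measure.map_apply hF hmeasA]
      simp
    have hQB : Q {p : γ × β | p.1 ≠ g p.2} = 0 := by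
      rw [hQ, Measure.map_apply hG hmeasB]
      simp
    simpa [hPA, hQB] using key

/-- **Coupling two presentations on `([0,1], Leb)` along equal laws of a statistic (registered anchor).**
If two measurable statistics `f, g : [0,1] → γ` (standard Borel `γ`, e.g. the countable vector of typed
surround counts of two limit configurations) have the same law under Lebesgue measure, the two copies of
`[0,1]` can be coupled so that `f p.1 = g p.2` almost surely. -/
theorem exists_coupling_volume_eq_of_map_eq : ∀ {γ : Type} [MeasurableSpace γ] [StandardBorelSpace γ]
    (f g : unitInterval → γ), Measurable f → Measurable g →
    (volume : Measure unitInterval).map f = (volume : Measure unitInterval).map g →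
    ∃ π : Measure (unitInterval × unitInterval), π.map Prod.fst = volume ∧ π.map Prod.snd = volume ∧
      ∀ᵐ p ∂π, f p.1 = g p.2 :=
  fun _ _ hf hg h ↦ exists_coupling_eq_of_map_eq volume volume hf hg h

end Summit.CriticalPhenomena.CardyFormulaZ2.Cruxes.NestingRigidity.PositiveConeWeightDoubling

end
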